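import Mathlib
import Literature.AlgebraicGeometry.Resolution.CobordantChartCoefficients
import Literature.AlgebraicGeometry.Resolution.CobordantChartPlaneSlice
import Summits.ResolutionOfSingularities.ResolutionOfSingularities.Theorems.WeightedInvariantLocalWeightedDropContactApprox

/-!
# Face drop for plane germs under the face-selected move `(X, (1, N))`

Crux `LocalWeightedDrop` (stmt-ResolutionOfSingularities-8899, route
ResolutionOfSingularities/WeightedInvariant), line `hasse-ridge-face-selection`, registered stub
`stub_faceDropPlane` of the skeleton `LocalWeightedDrop` (plane case `n = 2` of the local weighted
resolution game, rank = ORDER), PROVED here (statement verbatim from the registration).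

Setting (`x = X 0`, `y = X 1` in `k[[Fin 2]]`; `s = X 0`, `y₀ = X 1`, `y₁ = X 2` in `k[[Fin 3]]`).
`g` has contact `≥ N ≥ 1` (every monomial `xⁱyʲ` has `i + N j ≥ N d`) but NOT contact `≥ N + 1`,
its `y^d`-coefficient `a_d` is `≠ 0`, and its initial coefficients
`a_j := g_{(N(d-j), j)}`, `j ≤ d`, are not of the form `β C(d,j) (-a)^{d-j}` with `a ≠ 0`.  The
move is the chart `x ↦ s(c₀ + y₀)`, `y ↦ s^N(c₁ + y₁)` (`CobordantChart.chart ![1, N] c`) at a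
point `c ≠ 0`, `G` is the `s`-saturated transform (`g(chart) = sᵃ G`, `s ∤ G`) and
`H := G|_{y₀ = 0} ∈ k[[s, t]]` its flat slice.  CLAIM: if `G(0) = 0` then `c₀ ≠ 0` and
`ord H < d`.

Proof (all coefficient bookkeeping is in `Literature/…/CobordantChartPlaneSlice.lean`):
* `a = N d` (`CobordantChart.eq_weightedOrder_of_factor`: `a` is the `(1,N)`-order of `g`, which
  is `≥ N d` by contact and `≤ N d` as `a_d ≠ 0`), and
  `coeff (r, j) H = coeff (a + r, (0, j)) g(chart)`
  (`coeff_subst_slice_zero`, `CobordantChart.coeff_cons_of_eq_X_pow_mul`).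
* (A) `c₀ ≠ 0`: `G(0) = ∑_{m ≤ d} a_m c₀^{N(d-m)} c₁^m`; for `c₀ = 0` this is `a_d c₁^d`, so
  `G(0) = 0` forces `c₁ = 0`, contradicting `c ≠ 0`.
* (B) the `s⁰`-row `q_j := coeff (0, j) H = ∑_m a_m c₀^{N(d-m)} C(m,j) c₁^{m-j}`; if some
  `q_j ≠ 0` with `j < d` then `ord H ≤ j < d`.
* (C) otherwise `c₁ = 0`: the `q_j` are the Taylor coefficients at `c₁` of
  `P = ∑_m a_m c₀^{N(d-m)} Y^m`, so `P = a_d (Y - c₁)^d`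
  (`eq_C_mul_X_sub_C_pow_of_taylor_coeff_eq_zero`), i.e. `a_j = a_d C(d,j) (-c₁/c₀^N)^{d-j}` for
  all `j ≤ d`, which the normalisation forbids unless `c₁ = 0`.
* (D) for `c₁ = 0`, non-contact `N + 1` gives a monomial `xⁱyʲ` of `g` with
  `i + (N+1) j < (N+1) d`; its image is the slice monomial `s^{i + N j - N d} t^{j}` with
  coefficient `a_{ij} c₀^{i} ≠ 0` (`coeff_cons_subst_chart_plane_of_eq_zero`) and degree `< d`.
The hypotheses `g.order = d`, `2 ≤ d` and the linear part of "`G` singular" are not needed.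
-/

set_option linter.dupNamespace false -- mandated namespace of this single-conjunct summit

namespace Summit.ResolutionOfSingularities.ResolutionOfSingularities.Theorems

open Literature.AlgebraicGeometry.Resolution
open Literature.AlgebraicGeometry.Resolution.CobordantChartPlaneSlice

namespace FaceDropPlane

variable {k : Type} [Field k]

/-- Step 0: in the factorisation `g(chart) = sᵃ · G`, `s ∤ G`, the exponent is `a = N d`
(`a` is the `(1,N)`-order of `g`, which is `≥ N d` by contact and `≤ N d` by `a_d ≠ 0`). -/
theorem exponent_eq {g : MvPowerSeries (Fin 2) k} {d N : ℕ} (hN : 1 ≤ N)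
    (hcontact : ((N * d : ℕ) : ℕ∞) ≤ MvPowerSeries.weightedOrder ![1, N] g)
    (had : MvPowerSeries.coeff (Finsupp.single 1 d) g ≠ 0)
    {c : Fin 2 → k} {a : ℕ} {G : MvPowerSeries (Fin 3) k}
    (hfac : MvPowerSeries.subst (CobordantChart.chart ![1, N] c) g = MvPowerSeries.X 0 ^ a * G)
    (hndvd : ¬ MvPowerSeries.X (0 : Fin 3) ∣ G) : a = N * d := by
  have hg : g ≠ 0 := fun h => had (by rw [h, map_zero])
  have ha := CobordantChart.eq_weightedOrder_of_factor _ c (one_cons_convention hN c) hg hfac hndvd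
  have hle : MvPowerSeries.weightedOrder ![1, N] g ≤ ((N * d : ℕ) : ℕ∞) := by
    have h := MvPowerSeries.weightedOrder_le ![1, N] had
    rw [ContactApprox.weight_one_cons] at h
    simpa using h
  have h : (a : ℕ∞) = ((N * d : ℕ) : ℕ∞) := by
    rw [ha]
    exact le_antisymm hle hcontact
  exact_mod_cast h

/-- The coefficients of the flat slice `H = G|_{y₀ = 0} ∈ k[[s, t]]` are chart coefficients:
`coeff (r, j) H = coeff (r, 0, j) G = coeff (a + r, (0, j)) g(chart)`. -/
theorem coeff_slice {g : MvPowerSeries (Fin 2) k} {N : ℕ} {c : Fin 2 → k} {a : ℕ}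
    {G : MvPowerSeries (Fin 3) k}
    (hfac : MvPowerSeries.subst (CobordantChart.chart ![1, N] c) g = MvPowerSeries.X 0 ^ a * G)
    (r j : ℕ) :
    MvPowerSeries.coeff (Finsupp.single 0 r + Finsupp.single 1 j) (MvPowerSeries.subst
      (fun j : Fin 3 => if j = (0 : Fin 2).succ then (0 : MvPowerSeries (Fin 2) k)
        else MvPowerSeries.X (Fin.predAbove (0 : Fin 2) j)) G) =
      MvPowerSeries.coeff (Finsupp.cons (a + r) (Finsupp.single 1 j))
        (MvPowerSeries.subst (CobordantChart.chart ![1, N] c) g) := by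
  rw [coeff_subst_slice_zero, CobordantChart.coeff_cons_of_eq_X_pow_mul hfac]
  have h0 : (Finsupp.single 0 r + Finsupp.single 1 j : Fin 2 →₀ ℕ) 0 = r := by simp
  have h1 : (Finsupp.single 0 r + Finsupp.single 1 j : Fin 2 →₀ ℕ) 1 = j := by simp
  rw [h0, h1]

/-- (A): if `G(0) = 0` then `c₀ ≠ 0`.  For `c₀ = 0` the constant term of `G` is
`∑_{m ≤ d} a_m 0^{N(d-m)} c₁^m = a_d c₁^d`, so `c₁ = 0` too, contradicting `c ≠ 0`. -/
theorem c_zero_ne_zero {g : MvPowerSeries (Fin 2) k} {d N : ℕ} (hN : 1 ≤ N)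
    (had : MvPowerSeries.coeff (Finsupp.single 1 d) g ≠ 0)
    {c : Fin 2 → k} {G : MvPowerSeries (Fin 3) k} (hc : ∃ i, c i ≠ 0)
    (hfac : MvPowerSeries.subst (CobordantChart.chart ![1, N] c) g =
      MvPowerSeries.X 0 ^ (N * d) * G)
    (hG0 : MvPowerSeries.constantCoeff G = 0) : c 0 ≠ 0 := by
  intro hc0
  have h := hG0
  rw [← MvPowerSeries.coeff_zero_eq_constantCoeff_apply, ← Finsupp.cons_zero_zero,
    CobordantChart.coeff_cons_of_eq_X_pow_mul hfac, add_zero,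
    coeff_cons_mul_subst_chart_plane hN, Finset.sum_eq_single_of_mem d (by simp)] at h
  · have hc1 : c 1 = 0 := by
      simp only [Nat.sub_self, mul_zero, Finsupp.single_zero, zero_add, Finsupp.coe_zero,
        Pi.zero_apply, Nat.choose_zero_right, Nat.cast_one, pow_zero, mul_one, Nat.sub_zero,
        one_mul, mul_eq_zero] at h
      rcases h with h | h
      · exact absurd h had
      · exact eq_zero_of_pow_eq_zero h
    obtain ⟨i, hi⟩ := hc
    fin_cases i
    · exact hi hc0
    · exact hi hc1
  · intro m hm hmd
    have hm' : m < d := lt_of_le_of_ne (by simpa [Nat.lt_succ_iff] using hm) hmd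
    have hpos : N * (d - m) ≠ 0 := mul_ne_zero (by omega) (by omega)
    simp [hc0, zero_pow hpos]

/-- (B): the `s⁰`-row of the slice.  `q_j := coeff (N d, (0, j)) g(chart) =
∑_{m ≤ d} a_m c₀^{N(d-m)} · c₁^{m-j} C(m, j)` — the Taylor coefficients at `c₁` of the
polynomial `∑_m a_m c₀^{N(d-m)} Y^m`. -/
theorem row_coeff {g : MvPowerSeries (Fin 2) k} {d N : ℕ} (hN : 1 ≤ N) (c : Fin 2 → k)
    (j : ℕ) :
    MvPowerSeries.coeff (Finsupp.cons (N * d) (Finsupp.single 1 j))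
      (MvPowerSeries.subst (CobordantChart.chart ![1, N] c) g) =
      ∑ m ∈ Finset.range (d + 1),
        (MvPowerSeries.coeff (Finsupp.single 0 (N * (d - m)) + Finsupp.single 1 m) g *
          c 0 ^ (N * (d - m))) * (c 1 ^ (m - j) * (m.choose j : k)) := by
  rw [coeff_cons_mul_subst_chart_plane hN]
  refine Finset.sum_congr rfl fun m _ => ?_
  have h0 : (Finsupp.single 1 j : Fin 2 →₀ ℕ) 0 = 0 := by simp
  have h1 : (Finsupp.single 1 j : Fin 2 →₀ ℕ) 1 = j := by simp
  rw [h0, h1, Nat.choose_zero_right, Nat.cast_one, one_mul, Nat.sub_zero]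
  ring

/-- (C): if `c₀ ≠ 0` and all `q_j`, `j < d`, vanish, then `c₁ = 0`.  Otherwise the polynomial
`P = ∑_m a_m c₀^{N(d-m)} Y^m` has vanishing Taylor coefficients of order `< d` at `c₁`, so
`P = a_d (Y - c₁)^d`, i.e. `a_j = a_d C(d,j) (-c₁/c₀^N)^{d-j}` for all `j ≤ d` — excluded by the
normalisation hypothesis (with `a = c₁ / c₀^N ≠ 0`, `β = a_d`). -/
theorem c_one_eq_zero {g : MvPowerSeries (Fin 2) k} {d N : ℕ} (hN : 1 ≤ N) {c : Fin 2 → k}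
    (hc0 : c 0 ≠ 0)
    (hnorm : ∀ (a β : k), a ≠ 0 → ∃ j, j ≤ d ∧
      MvPowerSeries.coeff (Finsupp.single 0 (N * (d - j)) + Finsupp.single 1 j) g ≠
        β * (d.choose j : k) * (-a) ^ (d - j))
    (hq : ∀ j < d, MvPowerSeries.coeff (Finsupp.cons (N * d) (Finsupp.single 1 j))
      (MvPowerSeries.subst (CobordantChart.chart ![1, N] c) g) = 0) :
    c 1 = 0 := by
  by_contra hc1
  -- the initial coefficients `a_m` and the polynomial `P = ∑ a_m c₀^{N(d-m)} Y^m`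
  set aa : ℕ → k := fun m =>
    MvPowerSeries.coeff (Finsupp.single 0 (N * (d - m)) + Finsupp.single 1 m) g with haa
  set P : Polynomial k :=
    ∑ m ∈ Finset.range (d + 1), Polynomial.monomial m (aa m * c 0 ^ (N * (d - m))) with hP
  have hPcoeff : ∀ j, P.coeff j =
      if j ∈ Finset.range (d + 1) then aa j * c 0 ^ (N * (d - j)) else 0 := by
    intro j
    rw [hP, Polynomial.finsetSum_coeff]
    simp only [Polynomial.coeff_monomial]
    rw [Finset.sum_ite_eq']
  have hdeg : P.natDegree ≤ d := by
    rw [Polynomial.natDegree_le_iff_coeff_eq_zero]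
    intro j hj
    rw [hPcoeff, if_neg]
    simp only [Finset.mem_range]
    omega
  have htaylor : ∀ j < d, (Polynomial.taylor (c 1) P).coeff j = 0 := by
    intro j hj
    rw [hP, taylor_coeff_sum_monomial, ← hq j hj, row_coeff hN c j]
  have hPd : P.coeff d = aa d := by
    rw [hPcoeff, if_pos (by simp)]
    simp
  have hPeq := eq_C_mul_X_sub_C_pow_of_taylor_coeff_eq_zero P (c 1) d hdeg htaylor
  obtain ⟨j, hjd, hne⟩ := hnorm (c 1 / c 0 ^ N) (aa d) (div_ne_zero hc1 (pow_ne_zero _ hc0))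
  apply hne
  have hj := hPcoeff j
  rw [if_pos (Finset.mem_range.mpr (by omega)), hPeq, hPd, Polynomial.coeff_C_mul, sub_eq_add_neg,
    ← Polynomial.C_neg, Polynomial.coeff_X_add_C_pow] at hj
  -- hj : aa d * ((-c 1) ^ (d - j) * C(d, j)) = aa j * c 0 ^ (N * (d - j))
  have hpow : (-(c 1 / c 0 ^ N)) ^ (d - j) = (-c 1) ^ (d - j) / c 0 ^ (N * (d - j)) := by
    rw [pow_mul, ← div_pow, neg_div]
  show aa j = aa d * (d.choose j : k) * (-(c 1 / c 0 ^ N)) ^ (d - j)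
  rw [hpow]
  have hc0pow : c 0 ^ (N * (d - j)) ≠ 0 := pow_ne_zero _ hc0
  field_simp
  linear_combination -hj

/-- (D): if `c₀ ≠ 0`, `c₁ = 0` and `g` does NOT have contact `≥ N + 1`, the slice has order
`< d`: a monomial `xⁱ yʲ` of `g` with `i + (N+1) j < (N+1) d` (and `i + N j ≥ N d` by contact)
gives the slice monomial `s^{i + N j - N d} t^{j}` with coefficient `a_{ij} c₀^{i} ≠ 0` and degree
`< d`. -/
theorem order_slice_lt {g : MvPowerSeries (Fin 2) k} {d N : ℕ} (hN : 1 ≤ N)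
    (hcontact : ((N * d : ℕ) : ℕ∞) ≤ MvPowerSeries.weightedOrder ![1, N] g)
    (hnon : MvPowerSeries.weightedOrder ![1, N + 1] g < (((N + 1) * d : ℕ) : ℕ∞))
    {c : Fin 2 → k} (hc0 : c 0 ≠ 0) (hc1 : c 1 = 0) {G : MvPowerSeries (Fin 3) k}
    (hfac : MvPowerSeries.subst (CobordantChart.chart ![1, N] c) g =
      MvPowerSeries.X 0 ^ (N * d) * G) :
    MvPowerSeries.order (MvPowerSeries.subst
        (fun j : Fin 3 => if j = (0 : Fin 2).succ then (0 : MvPowerSeries (Fin 2) k)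
          else MvPowerSeries.X (Fin.predAbove (0 : Fin 2) j)) G) < (d : ℕ∞) := by
  -- a monomial of `g` strictly below the `(1, N+1)`-line
  obtain ⟨e, he, hlt⟩ : ∃ e : Fin 2 →₀ ℕ, MvPowerSeries.coeff e g ≠ 0 ∧
      e 0 + (N + 1) * e 1 < (N + 1) * d := by
    by_contra hall
    push Not at hall
    refine absurd hnon (not_lt.mpr ?_)
    apply MvPowerSeries.nat_le_weightedOrder
    intro e hwe
    rw [ContactApprox.weight_one_cons] at hwe
    by_contra hne
    exact absurd (hall e hne) (not_le.mpr hwe)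
  -- contact: `N d ≤ e 0 + N e 1`
  have hge : N * d ≤ e 0 + N * e 1 := by
    by_contra hlt'
    push Not at hlt'
    apply he
    apply MvPowerSeries.coeff_eq_zero_of_lt_weightedOrder ![1, N]
    rw [ContactApprox.weight_one_cons]
    exact lt_of_lt_of_le (by exact_mod_cast hlt') hcontact
  have h1 : (N + 1) * e 1 = N * e 1 + e 1 := by ring
  have h2 : (N + 1) * d = N * d + d := by ring
  -- the slice coefficient at `(r, e 1)`, `r = e 0 + N e 1 - N d`
  have hcoeff : MvPowerSeries.coeff
      (Finsupp.single 0 (e 0 + N * e 1 - N * d) + Finsupp.single 1 (e 1))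
      (MvPowerSeries.subst (fun j : Fin 3 => if j = (0 : Fin 2).succ then
        (0 : MvPowerSeries (Fin 2) k) else MvPowerSeries.X (Fin.predAbove (0 : Fin 2) j)) G) ≠
      0 := by
    rw [coeff_slice hfac]
    have : N * d + (e 0 + N * e 1 - N * d) = e 0 + N * e 1 := by omega
    rw [this, coeff_cons_subst_chart_plane_of_eq_zero hN c hc1 g e]
    exact mul_ne_zero he (pow_ne_zero _ hc0)
  refine lt_of_le_of_lt (MvPowerSeries.order_le hcoeff) ?_
  rw [map_add, Finsupp.degree_single, Finsupp.degree_single]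
  have : e 0 + N * e 1 - N * d + e 1 < d := by omega
  exact_mod_cast this

end FaceDropPlane

/-- FACE DROP FOR PLANE GERMS, stub `stub_faceDropPlane` of the line `hasse-ridge-face-selection`
of crux `LocalWeightedDrop` (stmt-ResolutionOfSingularities-8899): under the face-selected move
`(X, (1, N))` in normalised maximal-contact coordinates, every exceptional point `c ≠ 0` with a
singular `s`-saturated transform `G` has `c₀ ≠ 0` (a TAME slot), and the flat slice `G|_{y₀ = 0}`
has order `< d`. -/
theorem stub_faceDropPlane : ∀ (k : Type) [Field k] (g : MvPowerSeries (Fin 2) k) (d N : ℕ),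
    g.order = d → 2 ≤ d → 1 ≤ N →
    ((N * d : ℕ) : ℕ∞) ≤ MvPowerSeries.weightedOrder ![1, N] g →
    MvPowerSeries.weightedOrder ![1, N + 1] g < (((N + 1) * d : ℕ) : ℕ∞) →
    MvPowerSeries.coeff (Finsupp.single 1 d) g ≠ 0 →
    (∀ (a β : k), a ≠ 0 → ∃ j, j ≤ d ∧
      MvPowerSeries.coeff (Finsupp.single 0 (N * (d - j)) + Finsupp.single 1 j) g ≠
        β * (d.choose j : k) * (-a) ^ (d - j)) →
    ∀ (c : Fin 2 → k) (a : ℕ) (G : MvPowerSeries (Fin 3) k), (∃ i, c i ≠ 0) →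
      MvPowerSeries.subst (CobordantChart.chart ![1, N] c) g = MvPowerSeries.X 0 ^ a * G →
      ¬ (MvPowerSeries.X (0 : Fin 3) ∣ G) →
      (MvPowerSeries.constantCoeff G = 0 ∧ ∀ j, MvPowerSeries.coeff (Finsupp.single j 1) G = 0) →
      c 0 ≠ 0 ∧ MvPowerSeries.order (MvPowerSeries.subst
        (fun j : Fin 3 => if j = (0 : Fin 2).succ then (0 : MvPowerSeries (Fin 2) k)
          else MvPowerSeries.X (Fin.predAbove (0 : Fin 2) j)) G) < (d : ℕ∞) := by
  intro k _ g d N _hord _hd hN hcontact hnon had hnorm c a G hc hfac hndvd hsing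
  obtain rfl : a = N * d := FaceDropPlane.exponent_eq hN hcontact had hfac hndvd
  have hc0 : c 0 ≠ 0 := FaceDropPlane.c_zero_ne_zero hN had hc hfac hsing.1
  refine ⟨hc0, ?_⟩
  by_cases hq : ∃ j < d, MvPowerSeries.coeff (Finsupp.cons (N * d) (Finsupp.single 1 j))
      (MvPowerSeries.subst (CobordantChart.chart ![1, N] c) g) ≠ 0
  · -- (B): a non-zero `q_j`, `j < d`, is the coefficient of `t^j` in the slice
    obtain ⟨j, hjd, hj⟩ := hq
    have hcoeff : MvPowerSeries.coeff (Finsupp.single 0 0 + Finsupp.single 1 j)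
        (MvPowerSeries.subst (fun j : Fin 3 => if j = (0 : Fin 2).succ then
          (0 : MvPowerSeries (Fin 2) k) else MvPowerSeries.X (Fin.predAbove (0 : Fin 2) j)) G) ≠
        0 := by
      rw [FaceDropPlane.coeff_slice hfac, add_zero]
      exact hj
    refine lt_of_le_of_lt (MvPowerSeries.order_le hcoeff) ?_
    rw [map_add, Finsupp.degree_single, Finsupp.degree_single, zero_add]
    exact_mod_cast hjd
  · -- (C) + (D)
    push Not at hq
    have hc1 : c 1 = 0 := FaceDropPlane.c_one_eq_zero hN hc0 hnorm hq
    exact FaceDropPlane.order_slice_lt hN hcontact hnon hc0 hc1 hfac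

end Summit.ResolutionOfSingularities.ResolutionOfSingularities.Theorems
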